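import Mathlib
import Summits.Ventures.DiscreteObjects.Mahler.SubLehmerPentanomialShape
import Summits.Ventures.DiscreteObjects.Mahler.SubLehmerDegreeTwentyEight

/-!
# The sparse frontier of Lehmer's problem after 'Lehmer ≤ 27': pentanomials with `m ≥ 14` (venture `DiscreteObjects`, target L)

Cell `pub-namedobj`, seat `pub-namedobj-mahler-g28`. Framing: lottery ticket; floor = certified bounds/negative ranges.

Combination of two kernel results of the cell: `SubLehmerPentanomialShape.subLehmer_pentanomial_shape` (a sub-Lehmer
integer polynomial with exactly five monomials is `± x^j (x^{2m} + a x^{m+i} + c x^m + a x^{m-i} + 1)`, `0 < i < m`,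
`1 ≤ |a| ≤ 4`, `1 ≤ |c| ≤ 7`; [cite: AkhtariVaaler2019] height bound) and the kernel census
`SubLehmerDegreeTwentyEight.twentyeight_le_natDegree_of_subLehmer` ('Lehmer ≤ 27': a sub-Lehmer polynomial has degree
`≥ 28`): the reciprocal pentanomial is itself sub-Lehmer of degree `2m`, so **`m ≥ 14`**
(`subLehmer_pentanomial_shape_fourteen`).  Census bookkeeping; no new mathematics claimed.
-/

namespace Summit.Ventures.DiscreteObjects.Mahler

open Polynomial

/-- Degree of the pentanomial `x^{2m} + a x^{m+i} + c x^m + a x^{m-i} + 1`, `0 < i < m`. -/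
theorem natDegree_pentanomial {m i : ℕ} (hi : 0 < i) (him : i < m) (a c : ℤ) :
    (X ^ (2 * m) + C a * X ^ (m + i) + C c * X ^ m + C a * X ^ (m - i) + 1 : ℤ[X]).natDegree = 2 * m := by
  have h2m : (X ^ (2 * m) : ℤ[X]).natDegree = 2 * m := natDegree_X_pow _
  have h1 : (X ^ (2 * m) + C a * X ^ (m + i) : ℤ[X]).natDegree = 2 * m := by
    rw [natDegree_add_eq_left_of_natDegree_lt, h2m]
    rw [h2m]; exact (natDegree_C_mul_X_pow_le a (m + i)).trans_lt (by omega)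
  have h2 : (X ^ (2 * m) + C a * X ^ (m + i) + C c * X ^ m : ℤ[X]).natDegree = 2 * m := by
    rw [natDegree_add_eq_left_of_natDegree_lt, h1]
    rw [h1]; exact (natDegree_C_mul_X_pow_le c m).trans_lt (by omega)
  have h3 : (X ^ (2 * m) + C a * X ^ (m + i) + C c * X ^ m + C a * X ^ (m - i) : ℤ[X]).natDegree = 2 * m := by
    rw [natDegree_add_eq_left_of_natDegree_lt, h2]
    rw [h2]; exact (natDegree_C_mul_X_pow_le a (m - i)).trans_lt (by omega)
  rw [natDegree_add_eq_left_of_natDegree_lt, h3]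
  rw [h3, natDegree_one]; omega

/-- **The sparse frontier of Lehmer's problem after 'Lehmer ≤ 27'.**  A sub-Lehmer integer polynomial with exactly
five monomials is `± x^j (x^{2m} + a x^{m+i} + c x^m + a x^{m-i} + 1)` with `0 < i < m`, `1 ≤ |a| ≤ 4`, `1 ≤ |c| ≤ 7`
(`subLehmer_pentanomial_shape`) AND `m ≥ 14` — the reciprocal pentanomial is itself sub-Lehmer, hence of degree
`2m ≥ 28` by the kernel census (`twentyeight_le_natDegree_of_subLehmer`). -/
theorem subLehmer_pentanomial_shape_fourteen {P : ℤ[X]} (hP : SubLehmer P) (h5 : P.support.card = 5) :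
    ∃ (s : ℤ) (j m i : ℕ) (a c : ℤ), (s = 1 ∨ s = -1) ∧ 0 < i ∧ i < m ∧ 14 ≤ m ∧ a ≠ 0 ∧ c ≠ 0 ∧ |a| ≤ 4 ∧
      |c| ≤ 7 ∧ SubLehmer (X ^ (2 * m) + C a * X ^ (m + i) + C c * X ^ m + C a * X ^ (m - i) + 1) ∧
      P = C s * X ^ j * (X ^ (2 * m) + C a * X ^ (m + i) + C c * X ^ m + C a * X ^ (m - i) + 1) := by
  obtain ⟨s, j, m, i, a, c, hs, hi, him, ha, hc, ha4, hc7, hQ, hPQ⟩ := subLehmer_pentanomial_shape hP h5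
  refine ⟨s, j, m, i, a, c, hs, hi, him, ?_, ha, hc, ha4, hc7, hQ, hPQ⟩
  have h28 := twentyeight_le_natDegree_of_subLehmer hQ
  rw [natDegree_pentanomial hi him a c] at h28
  omega

end Summit.Ventures.DiscreteObjects.Mahler
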